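import Mathlib
import Summits.ValiantsHypothesis.ValiantsHypothesis.Theorems.GeneratorObstructionsPowGenDegreeQPRefutation

/-!
# Route GeneratorObstructions — crux K1 `PerGenDegreeSuperQP` (stmt-ValiantsHypothesis-11654), line
# `per-side-atoms`: K1 reduced to ONE orbit-closure membership

Helper file (`--supports stmt-ValiantsHypothesis-11654`).  The evaluation-lateness engine for K1
(`…PerGenDegreeSuperQPEvaluationLateness`, remark (2)) asked for a point of `Δ(per_m)` with the
support of a doubling gadget PLUS the Kempf–Hilbert–Mumford nonvanishing at it.  The second input is
now a theorem: `PowGenDegreeQP.canonicalGadgetGIT_gen` (…PowGenDegreeQPRefutation, the explicit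
tableau certificate) gives, for all `k, c ≥ 1` with `blockSum k ≠ 0` (e.g. `k = 2^t`), a highest-weight
vector of nonconstant weight of `ℂ[Δ_{5k} g]` not vanishing at the canonically placed doubling gadget
`g = Σ_{j<c} x_{B j}^k x_{A j}^{2k} x_{A' j}^{2k}` on the top `3c` letters of `MatIdx (5k)`.  Hence:

* `per_late_genType_of_gadget_mem` — **if the canonically placed gadget lies in `Δ(per_{5k})`
  (per in its own `(5k)²` lexicographic letters), then `A(Δ per_{5k})` has a nonconstant generator
  type with `-|χ| ≥ 2^c`** (`gadget_late_genType_of_eval_ne_zero` + the generator principle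
  `finrank_ne_zero_of_mem_orbitClosure`);
* `perGenDegreeSuperQP_of_gadget_mem` — **K1 by name from the membership at `k = 2^t`, `c = 4^t`
  for all `t ≥ 1`** (`gadget_parameters_at`: `5k · 2^((log₂ 5k + c₀)^c₀) < 2^c`).

So K1 now hinges on a single question of orbit-closure geometry: is the (unpadded, degree `5k`)
doubling gadget with `4^t` blocks a degeneration of `per_{5·2^t}`?  (Two blocks are: `per` of a
Hamiltonian-cycle support; the interleaved many-block sum is the open point.)

Honest framing: conditional reduction by name; no stub (`stub_atomLate`), crux or summit is settled
here; `VP ≠ VNP` untouched. [cite: GesmundoIkenmeyerPanova2017, Prop. 5]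
-/

namespace Summit.ValiantsHypothesis.ValiantsHypothesis.Theorems.GeneratorObstructions.PerGenDegreeSuperQP

open MvPolynomial
open Literature.NumberTheory.DiophantineGeometry Literature.Computability.AlgebraicComplexity
open Summit.ValiantsHypothesis.ValiantsHypothesis.Theses.GeneratorObstructions
open Summit.ValiantsHypothesis.ValiantsHypothesis.Theorems.GeneratorObstructions.SliceTransfer
open Summit.ValiantsHypothesis.ValiantsHypothesis.Theorems.GeneratorObstructions.PowGenDegreeQP

-- `Summit.ValiantsHypothesis.ValiantsHypothesis.…` is the tree's mandated single-conjunct layout.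
set_option linter.dupNamespace false

noncomputable section

/-- **A gadget in `Δ(per_{5k})` gives a late generator type of `per_{5k}`.**  For `k, c ≥ 1` with
`blockSum k ≠ 0` and the canonical placement `ι : Fin (3c) → MatIdx (5k)` (strictly monotone onto a
final segment): if `g = Σ_{j<c} x_{ι(B j)}^k x_{ι(A j)}^{2k} x_{ι(A' j)}^{2k}` lies in the orbit closure of
`per_{5k}` (own lexicographic letters), then `A(Δ per_{5k})` has a nonconstant generator type `χ` with
`-|χ| ≥ 2^c`. [cite: GesmundoIkenmeyerPanova2017, Prop. 5] -/
theorem per_late_genType_of_gadget_mem {k c : ℕ} (hk : 1 ≤ k) (hc : 1 ≤ c) (hbs : blockSum k ≠ 0)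
    (ι : Fin (3 * c) → MatIdx (5 * k)) (hι : StrictMono ι) (hup : IsUpperSet (Set.range ι))
    (hmem : (∑ j : Fin c,
        (X (ι ⟨if j.val = 0 then 0 else 3 * j.val - 1, canonPosB_lt j⟩) ^ k *
          (X (ι ⟨3 * j.val + 1, canonPosA_lt j⟩) ^ (2 * k) *
            X (ι ⟨if j.val = c - 1 then 3 * c - 1 else 3 * j.val + 3, canonPosA'_lt j⟩) ^ (2 * k)) :
        MvPolynomial (MatIdx (5 * k)) ℂ)) ∈
      orbitClosure (rename toLex (perPoly (Fin (5 * k)) ℂ) : MvPolynomial (MatIdx (5 * k)) ℂ)) :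
    ∃ χ : Weight (MatIdx (5 * k)), (∃ i j, χ i ≠ χ j) ∧ (2 : ℤ) ^ c ≤ -(Weight.size χ) ∧
      Module.finrank ℂ (↥(highestWeightSpace
          (orbitCoordRep (rename toLex (perPoly (Fin (5 * k)) ℂ)) (5 * k)) χ) ⧸
        Submodule.comap (highestWeightSpace
          (orbitCoordRep (rename toLex (perPoly (Fin (5 * k)) ℂ)) (5 * k)) χ).subtype
          (⨆ p : Weight (MatIdx (5 * k)) × Weight (MatIdx (5 * k)),
            ⨆ (_ : p.1 + p.2 = χ ∧ p.1 ≠ 0 ∧ p.2 ≠ 0),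
              highestWeightSpace (orbitCoordRep (rename toLex (perPoly (Fin (5 * k)) ℂ)) (5 * k)) p.1 *
                highestWeightSpace (orbitCoordRep (rename toLex (perPoly (Fin (5 * k)) ℂ)) (5 * k))
                  p.2)) ≠ 0 := by
  classical
  -- the canonical placement is unique: transfer its recorded properties to `ι`
  have hfit : 3 * c ≤ 5 * k * (5 * k) := by
    have h := Fintype.card_le_of_injective ι hι.injective
    rwa [Fintype.card_fin, Fintype.card_lex, Fintype.card_prod, Fintype.card_fin] at h
  obtain ⟨ι₀, hι₀, hup₀, hBi, hAi, hA'i, hBA, hBA', hAA', hord1, hord2⟩ :=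
    exists_canonicalPlacement (k := k) (c := c) (by omega) hfit
  have heq : ι = ι₀ := strictMono_eq_of_isUpperSet hι hup hι₀ hup₀
  subst heq
  -- late generator type of `A(Δ g)` from the explicit certificate
  obtain ⟨χ, hnc, hge, hγ⟩ := gadget_late_genType_of_eval_ne_zero
    (fun j : Fin c => ι ⟨if j.val = 0 then 0 else 3 * j.val - 1, canonPosB_lt j⟩)
    (fun j : Fin c => ι ⟨3 * j.val + 1, canonPosA_lt j⟩)
    (fun j : Fin c => ι ⟨if j.val = c - 1 then 3 * c - 1 else 3 * j.val + 3, canonPosA'_lt j⟩)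
    (by omega) hBi hAi hA'i hBA hBA' hAA' hord1 hord2 _ (m := 5 * k) (by omega) rfl
    (canonicalGadgetGIT_gen hk hc hbs ι hι hup)
  -- generator types go up along degenerations
  exact ⟨χ, hnc, hge, finrank_ne_zero_of_mem_orbitClosure (by omega) hmem χ hγ⟩

/-- Monotonicity of the quasi-polynomial exponent in the constant (`a ≥ 1`). [folklore] -/
theorem qpExp_mono {a c₀ c₁ : ℕ} (ha : 1 ≤ a) (h : c₀ ≤ c₁) : (a + c₀) ^ c₀ ≤ (a + c₁) ^ c₁ :=
  calc (a + c₀) ^ c₀ ≤ (a + c₁) ^ c₀ := Nat.pow_le_pow_left (by omega) _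
    _ ≤ (a + c₁) ^ c₁ := Nat.pow_le_pow_right (by omega) h

/-- **K1 from gadget membership.**  If for every `t ≥ 1` and the canonical placement
`ι : Fin (3·4^t) → MatIdx (5·2^t)` the doubling gadget with `k = 2^t`, `c = 4^t` lies in the orbit
closure of `per_{5·2^t}` (own lexicographic letters), then `PerGenDegreeSuperQP` holds: for `c₀, m₀`
take `t = 2(c₁+2)²`, `c₁ = max c₀ m₀`; the late generator type of `per_late_genType_of_gadget_mem` has
`-|χ| ≥ 2^(4^t) > 5·2^t · 2^((log₂(5·2^t) + c₀)^c₀)` (`gadget_parameters_at`).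
[cite: GesmundoIkenmeyerPanova2017, Prop. 5] -/
theorem perGenDegreeSuperQP_of_gadget_mem
    (hmem : ∀ (t : ℕ), 1 ≤ t → ∀ (ι : Fin (3 * 4 ^ t) → MatIdx (5 * 2 ^ t)),
      StrictMono ι → IsUpperSet (Set.range ι) →
      (∑ j : Fin (4 ^ t),
        (X (ι ⟨if j.val = 0 then 0 else 3 * j.val - 1, canonPosB_lt j⟩) ^ (2 ^ t) *
          (X (ι ⟨3 * j.val + 1, canonPosA_lt j⟩) ^ (2 * 2 ^ t) *
            X (ι ⟨if j.val = 4 ^ t - 1 then 3 * 4 ^ t - 1 else 3 * j.val + 3,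
              canonPosA'_lt j⟩) ^ (2 * 2 ^ t)) : MvPolynomial (MatIdx (5 * 2 ^ t)) ℂ)) ∈
        orbitClosure (rename toLex (perPoly (Fin (5 * 2 ^ t)) ℂ) :
          MvPolynomial (MatIdx (5 * 2 ^ t)) ℂ)) :
    PerGenDegreeSuperQP := by
  intro c₀ m₀
  set c₁ : ℕ := max c₀ m₀ with hc₁
  obtain ⟨ht, hfit, -, hlate⟩ := gadget_parameters_at c₁ (2 * (c₁ + 2) ^ 2) rfl
  set t : ℕ := 2 * (c₁ + 2) ^ 2 with htdef
  have hk1 : 1 ≤ 2 ^ t := Nat.one_le_two_pow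
  have hc1 : 1 ≤ 4 ^ t := Nat.one_le_pow _ _ (by norm_num)
  obtain ⟨ι, hι, hup, -⟩ := exists_canonicalPlacement (k := 2 ^ t) (c := 4 ^ t) (by omega) hfit
  obtain ⟨χ, -, hge, hγ⟩ := per_late_genType_of_gadget_mem hk1 hc1 (blockSum_two_pow_ne_zero t)
    ι hι hup (hmem t ht ι hι hup)
  refine ⟨5 * 2 ^ t, ?_, χ, hγ, ?_⟩
  · -- `m₀ ≤ c₁ ≤ t ≤ 2^t ≤ 5·2^t`
    have h1 : c₁ ≤ t := by rw [htdef]; nlinarith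
    have h2 : t ≤ 2 ^ t := Nat.lt_two_pow_self.le
    have h3 : m₀ ≤ c₁ := le_max_right _ _
    omega
  · -- lateness, with `c₀ ≤ c₁`
    have hmono : (5 * 2 ^ t : ℤ) * 2 ^ ((Nat.log 2 (5 * 2 ^ t) + c₀) ^ c₀) ≤
        (5 * 2 ^ t : ℤ) * 2 ^ ((Nat.log 2 (5 * 2 ^ t) + c₁) ^ c₁) := by
      apply mul_le_mul_of_nonneg_left _ (by positivity)
      have hlog : t + 2 ≤ Nat.log 2 (5 * 2 ^ t) := (log_two_five_mul_two_pow t).1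
      exact pow_le_pow_right₀ (by norm_num) (qpExp_mono (by omega) (le_max_left _ _))
    have hlate' : (5 * 2 ^ t : ℤ) * 2 ^ ((Nat.log 2 (5 * 2 ^ t) + c₁) ^ c₁) < (2 : ℤ) ^ (4 ^ t) := by
      exact_mod_cast hlate
    push_cast
    exact lt_of_lt_of_le (lt_of_le_of_lt hmono hlate') hge

end

end Summit.ValiantsHypothesis.ValiantsHypothesis.Theorems.GeneratorObstructions.PerGenDegreeSuperQP
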